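import Summits.HodgeConjecture.HodgeConjecture.Theorems.CurveNetMordellWeilAlgebraicInNormalForm
import Literature.AlgebraicGeometry.HodgeTheory.SaitoGrFDeRhamCurveNetHolds
import Literature.AlgebraicGeometry.Resolution.ProjectiveResolutionProofs

/-!
# Route `CurveNetMordellWeil` — support item `AlgebraicInNormalForm` (stmt-HodgeConjecture-18097), PROVED

THE EASY HALF OF THE MORDELL–WEIL NORMAL FORM: on a smooth projective `2p`-fold `X` (`p ≥ 1`) every class of
`Nᵖ H²ᵖ(X(ℂ); ℂ)` is a `ℂ`-combination of Gysin images of classes of `N¹ H²(W(ℂ); ℂ)` from smooth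
projective `(p+1)`-folds `f : W ⟶ X`.  The tree's CONDITIONAL theorem
`algebraicInNormalForm_of_deligne_of_hironaka` (file `CurveNetMordellWeilAlgebraicInNormalForm`) takes the two
named facts `Deligne1974_ker_restrictCompl_eq_iSup_range_complexGysin` (Deligne, Hodge III Cor. 8.2.8) and
`Resolution.Hironaka1964_projective` (projective Hironaka); both are now THEOREMS of the tree
(`Deligne1974_ker_restrictCompl_eq_iSup_range_complexGysin_holds`, file `HodgeTheory/SaitoGrFDeRhamCurveNetHolds`;
`Resolution.Hironaka1964_projective_holds`, file `Resolution/ProjectiveResolutionProofs`).  This file feeds them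
in.  No definition, no named-fact hypothesis, no sorry.
-/

noncomputable section

-- every declaration of this problem lives in `Summit.HodgeConjecture.HodgeConjecture.…` (summit = sub-problem)
set_option linter.dupNamespace false

namespace Summit.HodgeConjecture.HodgeConjecture.Theorems

open Literature.AlgebraicGeometry Literature.AlgebraicGeometry.HodgeTheory

/-- **Item stmt-HodgeConjecture-18097 (`AlgebraicInNormalForm`, route `CurveNetMordellWeil`)**: every
algebraic class of codimension `p` on a smooth projective `2p`-fold is a `ℂ`-combination of Gysin images of
divisor classes on smooth projective `(p+1)`-folds — `algebraicInNormalForm_of_deligne_of_hironaka` with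
Deligne's Cor. 8.2.8 and projective Hironaka discharged.  The type is literally the route decl
`Summit.HodgeConjecture.HodgeConjecture.Theses.CurveNetMordellWeil.AlgebraicInNormalForm`.
[cite: DeligneHodgeIII1974, Cor. 8.2.8] [cite: Kollar2007, Thm. 3.27] [cite: Fulton1998, §19.1] -/
theorem curveNetMordellWeil_algebraicInNormalForm_proof :
    Summit.HodgeConjecture.HodgeConjecture.Theses.CurveNetMordellWeil.AlgebraicInNormalForm :=
  algebraicInNormalForm_of_deligne_of_hironaka
    Deligne1974_ker_restrictCompl_eq_iSup_range_complexGysin_holds Resolution.Hironaka1964_projective_holds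

end Summit.HodgeConjecture.HodgeConjecture.Theorems

end
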